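import Summits.ResolutionOfSingularities.ResolutionOfSingularities.Theorems.EquisingularLiftEquisingularLiftNatNoseStrictTransformComap
import Summits.ResolutionOfSingularities.ResolutionOfSingularities.Theorems.EquisingularLiftEquisingularLiftNatNoseTraceTools
import Summits.ResolutionOfSingularities.ResolutionOfSingularities.Theorems.EquisingularLiftEquisingularLiftNatNoseSectionStepOfTrace
import Summits.ResolutionOfSingularities.ResolutionOfSingularities.Theorems.EquisingularLiftEquisingularLiftNatCentreCodimTwo
import Literature.AlgebraicGeometry.Resolution.NodalBlowupChartAlgebra
import Literature.AlgebraicGeometry.Resolution.ComponentGluing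
import HarnessLib

/-!
# [OURS · L1 W4.5(b) · EL♮(3) · door ν4, D7 brick HNODE] ★ THE TRACE CORE (P6) AND HNODE AT `RD := RPlus` — `hnode_rPlus`

res-L1-w45b-stub-2 g17 (HNODE pen; ROW desk g23 l.84094 / nose-w1 l.84115). `--supports stmt-ResolutionOfSingularities-20148 --as helper`, no claim,
counted 0. OURS; NOT a statement of [Hironaka2017]; AI-written, weaker than expert review. EL♮(3) is NOT proved here; char-p resolution is NOT proved
anywhere in this tree. DEF-FREE.

* ★ `hTrace_holds` — the trace core (P6) of ✓ `Equinodal.hnode_rPlus_of_trace` (…NatNoseSectionStepOfTrace), its binder VERBATIM: in the point-step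
  model square of the blow-up `τ` of ONE node section `s` over the point blow-up `υ` of `x = j⁻¹ s(𝔪_O)`, for the equinodal package `𝓛 ≤ 𝓦 ≤ ker s`
  (`SplitNodeAt` at `s(𝔪_O)`, traces `𝓘⟨closure E⟩`, `𝓘⟨W⟩`, `W̃` singular and `Ẽ` regular at `x`):
  `(St_τ 𝓦)·𝒪_{G'} = 𝓘⟨closure υ⁻¹(W ∖ {x})⟩`.
  Proof. At `p = j x`: `(ker s)_p = (e, u, v)` with `𝓛_p = (e)` and `𝓦_p = (e, au² + buv + cv² + h)`, `h ∈ (e) + (u,v)³`, `b² − 4ac` a unit, i.e.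
  `𝓦_p = (c₀, Φ₂(c) + Ψ₃(c))` is a NOSE on the frame `c = (e, u, v)`. The frame is quasi-regular up- and downstairs because `dim 𝒪_{X',p} = 4` and
  `dim 𝒪_{G,x} = 3` (✓ `ringKrullDim_eq_three_of_node`: `W̃` singular at `x` inside the regular `Ẽ` forbids `dim ≤ 2`; `𝔪_p = (e,u,v,ϖ)`,
  `ker j^♯_x = (ϖ)`), so `(e,u,v,ϖ)` resp. `(ē,ū,v̄)` are regular systems of parameters (tree `IsRsopPart.isQuasiRegular`). Then (F⁺5ⁿ)
  ✓ `comap_strictTransformIdeal_eq_of_model_nose` gives `(St_τ 𝓦)·𝒪_{G'} = St_υ(𝓘⟨W⟩)`, and ✓ `strictTransformIdeal_vanishingIdeal_eq` finishes.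
* ★ `hnode_rPlus` — HNODE: the supplier `hnode_rPlus` of ✓ `hsube_of_suppliers` (…NatEquinodalNoseOneStep, p676659) at `RD := RPlus k O θ P q Y Ch`,
  UNCONDITIONAL: `hnode_rPlus_of_trace … hTrace_holds`.

References: [cite: GortzWedhorn2020, (13.19), Prop. 13.91, Prop. 13.96] [cite: Matsumura1987, Thm. 14.2] [cite: StacksProject, Tag 0804].
-/

set_option linter.dupNamespace false

noncomputable section

open CategoryTheory CategoryTheory.Limits AlgebraicGeometry TopologicalSpace Topology IsLocalRing
open Literature.AlgebraicGeometry.Resolution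
open AlgebraicGeometry.Scheme.IdealSheafData
open Summit.ResolutionOfSingularities.ResolutionOfSingularities.Theses.EquisingularLift.Split
open Summit.ResolutionOfSingularities.ResolutionOfSingularities.Cruxes.EquisingularLift.StrataSplit

namespace Summit.ResolutionOfSingularities.ResolutionOfSingularities.Cruxes.EquisingularLiftNat.Sections.Equinodal

open Summit.ResolutionOfSingularities.ResolutionOfSingularities.Cruxes.EquisingularLiftNat.Sections
open MvPolynomial

set_option maxHeartbeats 1600000 in -- long binder; two chart-algebra stalk theorems inside F⁺5ⁿ; many stalk rewrites
/-- ★ **THE TRACE CORE (P6) of HNODE**: `(St_τ 𝓦)·𝒪_{G'} = 𝓘⟨closure υ⁻¹(W ∖ {x})⟩` for the equinodal nose through the blow-up of one node section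
(binder of ✓ `hnode_rPlus_of_trace`, verbatim). See the module docstring for the proof. [cite: GortzWedhorn2020, Prop. 13.91]
[cite: Matsumura1987, Thm. 14.2] [OURS · L1 W4.5b · D7 HNODE P6] -/
theorem hTrace_holds (k : Type) [Field k] (O : Type) [CommRing O] [IsDomain O] [IsDiscreteValuationRing O]
    (θ : O →+* k) (hθ : Function.Surjective θ) (P : Scheme.{0}) (q : P ⟶ Spec (.of O)) :
    ∀ {X' X'' G G' : Scheme.{0}} (σ' : X' ⟶ P) [IsIntegral X'] [IsLocallyNoetherian X'] [IsIntegral X''] [IsLocallyNoetherian X'']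
        [IsIntegral G] [IsLocallyNoetherian G] [IsIntegral G'] [IsLocallyNoetherian G'],
        Scheme.IsRegular X' → IsDominant (σ' ≫ q) → ∀ (j : G ⟶ X') (t : G ⟶ Spec (.of k)), IsPullback j t (σ' ≫ q) (Spec.map (CommRingCat.ofHom θ)) →
        ∀ (s : Spec (.of O) ⟶ X'), s ≫ σ' ≫ q = 𝟙 _ → ∀ (τ : X'' ⟶ X'), IsBlowup τ s.ker → Scheme.IsRegular X'' →
        ∀ (υ : G' ⟶ G) (x : G) (hx : IsClosed ({x} : Set G)), IsBlowup υ (vanishingIdeal ⟨{x}, hx⟩) → s (closedPoint O) = j x →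
        s.ker.comap j = vanishingIdeal ⟨{x}, hx⟩ → Scheme.IsRegular s.ker.subscheme → Flat (s.ker.subschemeι ≫ σ' ≫ q) → IsClosedImmersion s →
        ∀ (j₂ : G' ⟶ X'') (t₂ : G' ⟶ Spec (.of k)), IsPullback j₂ t₂ ((τ ≫ σ') ≫ q) (Spec.map (CommRingCat.ofHom θ)) → j₂ ≫ τ = υ ≫ j →
        ∀ (𝓛 𝓦 : X'.IdealSheafData), 𝓛 ≤ 𝓦 → 𝓦 ≤ s.ker → (∀ z : X', (stalkIdeal 𝓛 z).IsPrincipal) → Scheme.IsRegular 𝓛.subscheme → 𝓛 ≠ ⊥ →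
        Flat (𝓛.subschemeι ≫ σ' ≫ q) →
        (∀ z : X'', (stalkIdeal (strictTransformIdeal τ s.ker 𝓛) z).IsPrincipal) → Scheme.IsRegular (strictTransformIdeal τ s.ker 𝓛).subscheme →
        ∀ (E : Set G), 𝓛.comap j = vanishingIdeal (⟨closure E, isClosed_closure⟩ : Closeds G) →
        ∀ (W : Set G) (hW : IsClosed W), 𝓦.comap j = vanishingIdeal (⟨W, hW⟩ : Closeds G) → Flat (𝓦.subschemeι ≫ σ' ≫ q) →
        IsIntegral 𝓦.subscheme → IsIrreducible W → x ∈ W → SplitNodeAt X' 𝓛 𝓦 s.ker (s (closedPoint O)) →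
        IsRegularLocalRing (G.presheaf.stalk x) →
        (x ∈ closure E → ∀ e : ↥(redSub G (closure E) isClosed_closure), (redSubι G (closure E) isClosed_closure e : G) = x →
          IsRegularLocalRing ((redSub G (closure E) isClosed_closure).presheaf.stalk e)) →
        (∀ w' : ↥(redSub G W hW), (redSubι G W hW w' : G) = x → ¬ IsRegularLocalRing ((redSub G W hW).presheaf.stalk w')) →
        (strictTransformIdeal τ s.ker 𝓦).comap j₂ = vanishingIdeal (⟨closure (υ ⁻¹' (W \ {x})), isClosed_closure⟩ : Closeds G') := by
  intro X' X'' G G' σ' _ _ _ _ _ _ _ _ hX'r _hdom j t hsq s _hss τ hτ _hX''r υ x hx hυ hss₀ hCD hCreg _hCfl _hsci j₂ _t₂ _hsq₂ hcomm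
    𝓛 𝓦 h𝓛𝓦 _h𝓦𝔰 h𝓛pr _h𝓛reg h𝓛0 h𝓛fl _h𝓛₁pr _h𝓛₁reg E h𝓛tr W hW h𝓦tr _h𝓦fl _h𝓦int hWirr hxW hsplit hGreg hEreg hWsing
  classical
  obtain ⟨ϖ, hϖ⟩ := IsDiscreteValuationRing.exists_irreducible O
  have hϖO : ϖ ∈ maximalIdeal O := by rw [hϖ.maximalIdeal_eq]; exact Ideal.mem_span_singleton_self ϖ
  haveI hRreg : IsRegularLocalRing (X'.presheaf.stalk (j x)) := hX'r (j x)
  haveI : IsRegularLocalRing (G.presheaf.stalk x) := hGreg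
  haveI := h𝓛fl
  -- (1) the split node at `j x`
  rw [hss₀] at hsplit
  obtain ⟨u, v, g, a, b, cc, h, hS, hWst, hg, hh, hunit⟩ := hsplit
  obtain ⟨e, he⟩ := (h𝓛pr (j x)).principal
  change stalkIdeal 𝓛 (j x) = Ideal.span {e} at he
  -- (2) the model square at `x`: `j^♯_x` onto with kernel `(ϖ)`, `j x` over the closed point
  have hφsurj : Function.Surjective (j.stalkMap x).hom := stalkMap_model_surjective θ hθ (σ' ≫ q) j t hsq x
  set ϖR : X'.presheaf.stalk (j x) :=
    (X'.presheaf.Γgerm (j x)).hom ((σ' ≫ q).appTop.hom ((Scheme.ΓSpecIso (.of O)).inv.hom ϖ)) with hϖR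
  have hkerφ : RingHom.ker (j.stalkMap x).hom = Ideal.span {ϖR} := by
    refine le_antisymm (ker_stalkMap_model_le O k θ hθ (σ' ≫ q) j t hsq x ϖ hϖ) ?_
    rw [Ideal.span_le, Set.singleton_subset_iff, SetLike.mem_coe, RingHom.mem_ker]
    exact stalkMap_model_varpi θ hθ (σ' ≫ q) j t hsq x ϖ hϖO
  have hjx : (σ' ≫ q) (j x) = closedPoint O := by
    have h1 : j x ∈ Set.range j := ⟨x, rfl⟩
    rw [range_eq_preimage_of_isPullback hsq, range_specMap_of_surjective_of_field θ hθ] at h1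
    exact h1
  have hϖm : ϖR ∈ maximalIdeal (X'.presheaf.stalk (j x)) := CILift.germ_varpi_mem_maximalIdeal O (σ' ≫ q) ϖ hϖ (j x) hjx
  -- (3) the frame `c = (e, u, v)` of `(ker s)_{j x}` and its image `c̄` generating `𝔪_x`
  set c : Fin 3 → X'.presheaf.stalk (j x) := ![e, u, v] with hc
  have hrange : Set.range c = {e, u, v} := by
    simp only [hc, Matrix.range_cons, Matrix.range_empty, Set.union_empty, Set.singleton_union]
  have hcS : Ideal.span (Set.range c) = stalkIdeal s.ker (j x) := by
    rw [hrange, hS, he, Ideal.span_insert]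
  set cb : Fin 3 → G.presheaf.stalk x := fun i => (j.stalkMap x).hom (c i) with hcb
  have hrangeb : Set.range cb = (j.stalkMap x).hom '' Set.range c := by rw [hcb]; exact Set.range_comp _ _
  have hcb𝔪 : Ideal.span (Set.range cb) = maximalIdeal (G.presheaf.stalk x) := by
    rw [hrangeb, ← Ideal.map_span, hcS, ← stalkIdeal_comap_eq_map_stalkMap, hCD, stalkIdeal_vanishingIdeal_singleton hx]
  have h𝔪R : maximalIdeal (X'.presheaf.stalk (j x)) = Ideal.span (Set.range c) ⊔ Ideal.span {ϖR} := by
    have h1 : (maximalIdeal (G.presheaf.stalk x)).comap (j.stalkMap x).hom = maximalIdeal (X'.presheaf.stalk (j x)) :=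
      IsLocalRing.eq_maximalIdeal (Ideal.comap_isMaximal_of_surjective _ hφsurj)
    rw [← h1, ← hcb𝔪, hrangeb, ← Ideal.map_span, Ideal.comap_map_of_surjective _ hφsurj, ← RingHom.ker_eq_comap_bot, hkerφ]
  have hc𝔪 : Ideal.span (Set.range c) ≤ maximalIdeal (X'.presheaf.stalk (j x)) := by rw [h𝔪R]; exact le_sup_left
  have he𝔪 : e ∈ maximalIdeal (X'.presheaf.stalk (j x)) := hc𝔪 (Ideal.subset_span ⟨0, rfl⟩)
  have h𝓛supp : j x ∈ (𝓛.support : Set X') :=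
    (mem_support_iff_stalkIdeal_le 𝓛 (j x)).mpr (by rw [he, Ideal.span_le, Set.singleton_subset_iff]; exact he𝔪)
  have hSsupp : j x ∈ (s.ker.support : Set X') := (mem_support_iff_stalkIdeal_le s.ker (j x)).mpr (hcS ▸ hc𝔪)
  -- (4) `e ≠ 0`, `ϖ ≠ 0`, `ē ≠ 0` (`𝓛 ≠ ⊥`; flatness of `V(𝓛)` over `O`)
  have he0 : e ≠ 0 := by
    intro h0; apply stalkIdeal_ne_bot_of_ne_bot h𝓛0 (j x); rw [he, h0, Ideal.span_singleton_eq_bot]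
  have hϖR0 : ϖR ≠ 0 := by
    intro h0
    have h1 : (1 : X'.presheaf.stalk (j x)) ∈ stalkIdeal 𝓛 (j x) :=
      mem_stalkIdeal_of_varpi_mul_mem_of_flat (σ' ≫ q) 𝓛 (j x) h𝓛supp hϖ.ne_zero 1 (by
        change ϖR * 1 ∈ _
        rw [h0, zero_mul]; exact Submodule.zero_mem _)
    exact (maximalIdeal.isMaximal _).ne_top
      (Ideal.eq_top_of_isUnit_mem _ ((mem_support_iff_stalkIdeal_le 𝓛 (j x)).mp h𝓛supp h1) isUnit_one)
  have heb0 : (j.stalkMap x).hom e ≠ 0 := by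
    intro h0
    have h1 : e ∈ RingHom.ker (j.stalkMap x).hom := h0
    rw [hkerφ] at h1
    obtain ⟨r, hr⟩ := Ideal.mem_span_singleton'.mp h1
    have h2 : r ∈ stalkIdeal 𝓛 (j x) :=
      mem_stalkIdeal_of_varpi_mul_mem_of_flat (σ' ≫ q) 𝓛 (j x) h𝓛supp hϖ.ne_zero r (by
        change ϖR * r ∈ _
        rw [mul_comm, hr, he]; exact Ideal.mem_span_singleton_self e)
    rw [he] at h2
    obtain ⟨r', hr'⟩ := Ideal.mem_span_singleton'.mp h2
    have h3 : e * (1 - r' * ϖR) = 0 := by linear_combination (-1 : X'.presheaf.stalk (j x)) * hr + (-ϖR) * hr'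
    have h4 : IsUnit (1 - r' * ϖR) :=
      IsLocalRing.isUnit_one_sub_self_of_mem_nonunits _
        ((IsLocalRing.mem_maximalIdeal _).mp (Ideal.mul_mem_left _ r' hϖm))
    exact he0 ((h4.mul_left_eq_zero).mp h3)
  -- (5) the host trace `Ẽ` through `x`: `𝒪_{G,x}/(ē)` is regular
  have heb𝔪 : (j.stalkMap x).hom e ∈ maximalIdeal (G.presheaf.stalk x) := hcb𝔪 ▸ Ideal.subset_span ⟨0, rfl⟩
  have hEst : stalkIdeal (𝓛.comap j) x = Ideal.span {(j.stalkMap x).hom e} := by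
    rw [stalkIdeal_comap_eq_map_stalkMap, he, Ideal.map_span, Set.image_singleton]
  have hxE : x ∈ closure E := by
    have h1 : x ∈ ((𝓛.comap j).support : Set G) :=
      (mem_support_iff_stalkIdeal_le _ x).mpr (by rw [hEst, Ideal.span_le, Set.singleton_subset_iff]; exact heb𝔪)
    rw [h𝓛tr, Scheme.IdealSheafData.coe_support_vanishingIdeal] at h1
    exact h1
  obtain ⟨e', he'⟩ : x ∈ Set.range (redSubι G (closure E) isClosed_closure) := by
    rw [Scheme.IdealSheafData.range_subschemeι, Scheme.IdealSheafData.coe_support_vanishingIdeal]; exact hxE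
  have hBreg : IsRegularLocalRing (G.presheaf.stalk x ⧸ Ideal.span {(j.stalkMap x).hom e}) := by
    have h1 := (isRegularLocalRing_subscheme_stalk_iff_of_eq _ e' x he').mp (hEreg hxE e' he')
    rwa [← h𝓛tr, hEst] at h1
  -- (6) the reduced nose `W̃` through `x`: `𝒪_{G,x}/𝓘⟨W⟩_x` is a NON-regular domain
  obtain ⟨w', hw'⟩ : x ∈ Set.range (redSubι G W hW) := by
    rw [Scheme.IdealSheafData.range_subschemeι, Scheme.IdealSheafData.coe_support_vanishingIdeal]; exact hxW
  have hAsing : ¬ IsRegularLocalRing (G.presheaf.stalk x ⧸ stalkIdeal (𝓦.comap j) x) := by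
    rw [h𝓦tr]; exact fun hreg => hWsing w' hw' ((isRegularLocalRing_subscheme_stalk_iff_of_eq _ w' x hw').mpr hreg)
  haveI : IsIntegral (redSub G W hW) := ComponentGluing.isIntegral_subscheme_vanishingIdeal ⟨W, hW⟩ hWirr
  haveI h𝔞prime : (stalkIdeal (𝓦.comap j) x).IsPrime := by
    rw [h𝓦tr]
    haveI := isDomain_quotient_stalkIdeal_of_eq _ w' x hw'
    exact (Ideal.Quotient.isDomain_iff_prime _).mp ‹_›
  have h𝔞E : Ideal.span {(j.stalkMap x).hom e} ≤ stalkIdeal (𝓦.comap j) x := by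
    rw [← hEst, stalkIdeal_comap_eq_map_stalkMap, stalkIdeal_comap_eq_map_stalkMap]
    exact Ideal.map_mono (stalkIdeal_mono h𝓛𝓦 _)
  -- (7) dimensions: `dim 𝒪_{G,x} = 3`, `dim 𝒪_{X',j x} = 4`
  have hdimA : ringKrullDim (G.presheaf.stalk x) = (3 : ℕ) :=
    ringKrullDim_eq_three_of_node hcb𝔪 heb0 heb𝔪 hBreg h𝔞E hAsing
  have eRA : (X'.presheaf.stalk (j x) ⧸ Ideal.span {ϖR}) ≃+* G.presheaf.stalk x :=
    (Ideal.quotEquivOfEq hkerφ.symm).trans (RingHom.quotientKerEquivOfSurjective hφsurj)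
  have hdimR : ringKrullDim (X'.presheaf.stalk (j x)) = ((3 + 1 : ℕ) : WithBot ℕ∞) := by
    have h1 := ringKrullDim_quotient_span_singleton_succ_eq_ringKrullDim_of_mem_nonZeroDivisors
      (mem_nonZeroDivisors_of_ne_zero hϖR0) hϖm
    rw [ringKrullDim_eq_of_ringEquiv eRA, hdimA] at h1
    rw [← h1, Nat.cast_add, Nat.cast_one]
  -- (8) `(e, u, v, ϖ)` and `(ē, ū, v̄)` are regular systems of parameters: both frames are quasi-regular
  have hc_qr : IsQuasiRegular c := by
    refine IsRsopPart.isQuasiRegular ⟨hRreg, 1, ![ϖR], hdimR, ?_⟩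
    rw [Ideal.span_union, h𝔪R]
    simp only [Matrix.range_cons, Matrix.range_empty, Set.union_empty]
  have hcbar : IsQuasiRegular cb := by
    refine IsRsopPart.isQuasiRegular ⟨hGreg, 0, ![], ?_, ?_⟩
    · rw [Nat.add_zero]; exact hdimA
    · simp only [Matrix.range_empty, Set.union_empty]; exact hcb𝔪
  -- (9) `𝒪_{X',jx}/(c) ≅ 𝒪_{V(ker s)}` is a domain; `𝒪_{G,x}/(c̄)` is the residue field
  obtain ⟨zS, hzS⟩ : j x ∈ Set.range s.ker.subschemeι := by rw [Scheme.IdealSheafData.range_subschemeι]; exact hSsupp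
  haveI : IsDomain (X'.presheaf.stalk (j x) ⧸ Ideal.span (Set.range c)) := by
    rw [hcS]
    haveI := (isRegularLocalRing_subscheme_stalk_iff_of_eq s.ker zS (j x) hzS).mp (hCreg zS)
    exact isDomain_of_isRegularLocalRing _
  haveI : IsDomain (G.presheaf.stalk x ⧸ Ideal.span (Set.range cb)) := isDomain_quotient_span_of_span_eq_maximalIdeal hcb𝔪
  -- (10) the nose: `𝓦_{jx} = (c₀, Φ₂(c) + Ψ₃(c))`
  set Φ₂ : MvPolynomial (Fin 3) (X'.presheaf.stalk (j x)) := C a * X 1 ^ 2 + C b * X 1 * X 2 + C cc * X 2 ^ 2 with hΦ₂def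
  have hΦ₂ : Φ₂.IsHomogeneous 2 := noseForm_isHomogeneous a b cc
  rw [he] at hh
  obtain ⟨y, hy, z, hz, hyz⟩ := Submodule.mem_sup.mp hh
  obtain ⟨m, rfl⟩ := Ideal.mem_span_singleton'.mp hy
  have hz3 : z ∈ Ideal.span (Set.range c) ^ 3 := by
    refine Ideal.pow_right_mono ?_ 3 hz
    rw [hrange]; exact Ideal.span_mono (Set.subset_insert _ _)
  obtain ⟨Ψ₃, hΨ₃, hΨ₃ev⟩ := exists_isHomogeneous_of_mem_span_pow c 3 hz3
  have hK : stalkIdeal 𝓦 (j x) = Ideal.span {c 0, MvPolynomial.eval c Φ₂ + MvPolynomial.eval c Ψ₃} := by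
    have h0 : c 0 = e := rfl
    have hev : MvPolynomial.eval c Φ₂ = a * u ^ 2 + b * u * v + cc * v ^ 2 := by
      rw [hΦ₂def, noseForm_eval]; rfl
    have hg' : g = (a * u ^ 2 + b * u * v + cc * v ^ 2 + z) + m * e := by rw [hg, ← hyz]; ring
    rw [hWst, he, ← Ideal.span_insert, h0, hev, hΨ₃ev, hg', Ideal.span_pair_add_mul_left]
  -- (11) the reduced dehomogenisations of `Φ₂`, up- and downstairs, avoid `T₀`
  have hΦ₀ : ∀ (i : Fin 3) (hne : (0 : Fin 3) ≠ i),
      MvPolynomial.map (Ideal.Quotient.mk (Ideal.span (Set.range c))) (dehomogenize i Φ₂) ∉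
        Ideal.span (MvPolynomial.X '' ({⟨0, hne⟩} : Set {j : Fin 3 // j ≠ i})) :=
    fun i hne => noseForm_dehomogenize_notMem _ a b cc hunit i hne
  have hunitb : IsUnit (((j.stalkMap x).hom b) ^ 2 - 4 * (j.stalkMap x).hom a * (j.stalkMap x).hom cc) := by
    have h1 := hunit.map (j.stalkMap x).hom
    simp only [map_sub, map_mul, map_pow, map_ofNat] at h1
    exact h1
  have hΦbar : ∀ (i : Fin 3) (hne : (0 : Fin 3) ≠ i),
      MvPolynomial.map (Ideal.Quotient.mk (Ideal.span (Set.range cb))) (dehomogenize i (MvPolynomial.map (j.stalkMap x).hom Φ₂)) ∉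
        Ideal.span (MvPolynomial.X '' ({⟨0, hne⟩} : Set {j : Fin 3 // j ≠ i})) := by
    intro i hne
    rw [hΦ₂def, noseForm_map]
    exact noseForm_dehomogenize_notMem _ _ _ _ hunitb i hne
  -- (12) F⁺5ⁿ and the reduced strict transform of `W`
  have key := comap_strictTransformIdeal_eq_of_model_nose τ s.ker 𝓦 hτ j υ j₂ hcomm x hx hυ hCD c hcS hc_qr 0 Φ₂ Ψ₃ hΦ₂ hΨ₃
    hΦ₀ hK hcbar hΦbar
  rw [key, h𝓦tr, Sections.strictTransformIdeal_vanishingIdeal_eq υ (vanishingIdeal ⟨{x}, hx⟩) hυ W hW]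
  simp only [Scheme.IdealSheafData.coe_support_vanishingIdeal, TopologicalSpace.Closeds.coe_mk]

/-- ★ **HNODE — the equinodal nose datum through the blow-up of ONE node section, at `RD := RPlus k O θ P q Y Ch`**: the supplier
`hnode_rPlus` of ✓ `hsube_of_suppliers` (p676659), UNCONDITIONAL (`hnode_rPlus_of_trace` with the trace core `hTrace_holds`).
[cite: GortzWedhorn2020, Prop. 13.91] [OURS · L1 W4.5b · door ν4 · D7 HNODE, counted 0] -/
theorem hnode_rPlus (k : Type) [Field k] [IsAlgClosed k]
    (O : Type) [CommRing O] [IsDomain O] [IsDiscreteValuationRing O] [IsAdicComplete (IsLocalRing.maximalIdeal O) O]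
    [IsAlgClosed (IsLocalRing.ResidueField O)] (θ : O →+* k) (hθ : Function.Surjective θ)
    (P : Scheme.{0}) (q : P ⟶ Spec (.of O)) (Y : Set P) (Ch : ∀ X' : Scheme.{0}, (X' ⟶ P) → Set X' → Prop)
    (hChStep : ∀ (X' X'' : Scheme.{0}) (σ' : X' ⟶ P) (S' : Set X') (C : X'.IdealSheafData) (τ : X'' ⟶ X'),
      Ch X' σ' S' → IsBlowup τ C → Scheme.IsRegular C.subscheme → Flat (C.subschemeι ≫ σ' ≫ q) →
      σ' '' (C.support : Set X') ⊆ {y | ¬ IsGenericPoint y Y} → (C.support : Set X') ∩ (σ' ≫ q) ⁻¹' {IsLocalRing.closedPoint O} ⊆ S' →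
      Ch X'' (τ ≫ σ') (closure (τ ⁻¹' (S' \ (C.support : Set X')))))
    (hChSplit : ∀ (X' : Scheme.{0}) (σ' : X' ⟶ P) (S' : Set X'), Ch X' σ' S' → Chain P Y X' σ' S')
    (hYsp : Y ⊆ q ⁻¹' {IsLocalRing.closedPoint O}) (hYirr : IsIrreducible Y) (hYcl : IsClosed Y) (hPint : IsIntegral P)
    (hPnoeth : IsLocallyNoetherian P) (hPreg : Scheme.IsRegular P) (hqprop : IsProper q) (hqsm : SmoothOfRelativeDimension 3 q) :
    ∀ (G G' : Scheme.{0}) (γ : G ⟶ (Literature.AlgebraicGeometry.Motives.projectiveSpace 3 k).left) (T E W : Set G) (hW : IsClosed W)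
        (w : ↥(redSub G W hW)) (υ₁ : G' ⟶ G) (hy : IsClosed ({(redSubι G W hW w : G)} : Set G)),
      RPlus k O θ P q Y Ch G γ T E W → W ⊆ T → ¬ IsRegularLocalRing ((redSub G W hW).presheaf.stalk w) →
      IsRegularLocalRing (G.presheaf.stalk (redSubι G W hW w : G)) →
      ((redSubι G W hW w : G) ∈ closure E → ∀ e : ↥(redSub G (closure E) isClosed_closure),
        (redSubι G (closure E) isClosed_closure e : G) = (redSubι G W hW w : G) →
        IsRegularLocalRing ((redSub G (closure E) isClosed_closure).presheaf.stalk e)) →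
      IsBlowup υ₁ (vanishingIdeal (⟨{(redSubι G W hW w : G)}, hy⟩ : Closeds G)) →
      RPlus k O θ P q Y Ch G' (υ₁ ≫ γ) (closure (υ₁ ⁻¹' (T \ {(redSubι G W hW w : G)}))) (closure (υ₁ ⁻¹' (E \ {(redSubι G W hW w : G)})))
        (closure (υ₁ ⁻¹' (W \ {(redSubι G W hW w : G)}))) :=
  hnode_rPlus_of_trace k O θ hθ P q Y Ch hChStep hChSplit hYsp hYirr hYcl hPint hPnoeth hPreg hqprop hqsm (hTrace_holds k O θ hθ P q)

end Summit.ResolutionOfSingularities.ResolutionOfSingularities.Cruxes.EquisingularLiftNat.Sections.Equinodal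

end
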